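import Summits.QuantumFields.YangMills.Theorems.BalabanUVNodesN15KingModelCombesThomasLipschitz
import HarnessLib

/-!
# BalabanUVNodes ∕ N15 — THE KING-MODEL RUNG (PART Ϧ-i): LOCALITY OF THE BACKGROUND PROPAGATOR IN THE FIELD — a perturbation of `A₀` whose fibre blocks live on a set `Z` of sites changes
# `blk G x y` by at most `(2∕κ)²·(mass of the perturbation)·e^{−ctRate·(R_x + R_y)∕L}` whenever `d(x,Z) ≥ R_x`, `d(Z,y) ≥ R_y`: far from the support, the two propagators agree up to an
# exponentially small error, `η`-uniformly in the rate
# (Track A, DAG node N15 = NE2; FAN-OUT v1.1 §N15 s3 «KING-MODEL RUNG … + what the curved case adds»; count-neutral)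

EDITION v1.1 (DOC-ONLY, ERRATUM-Ϧ1, 2026-08-31): locators corrected after ref-J READ-769∕770 — [Balaban1985BackgroundPropagators] (3.37) is on p.396 (not p.397) and (3.48)–(3.50) span pp.398–400 (not p.398),
verified first-hand on the held text (journal page = 388 + file page).  Declarations byte-identical to v1.0.

HONEST FRAMING.  Count-neutral (cell `pub-ymgap`, seat `pub-ymgap-dag-n15-e` g50; `--supports stmt-QuantumFields-27247 --as helper` = K3ᴬ, KEY MAP v3).  King's one-level comparison model; two
`κ`-coercive full operators `A, A′` on the same carrier (e.g. `A₀(U)`, `A₀(V)` at two unitary fields that differ only near `Z` — the support of `A₀(U) − A₀(V)` is NOT computed here: it is a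
hypothesis on the blocks of the difference); King's scaling.  The `mass` `Σ_{z,z′∈Z}‖blk (A − A′) z z′‖` is an honest `ℓ²`-operator quantity (it carries the Laplacian's `L²` for hopping
perturbations, as in PART Ϧ-f).  NOT Bałaban's (3.48)–(3.50); NOT a node discharge (N15 of record untouched); nothing continuum ∕ ℝ⁴ ∕ OS ∕ Clay.

THE RESULTS (`T` a tree contour system, King's scaling `c = L²`, `a ≥ 0`, `L ≥ 1`; `A = A₀(U)`, `A′ = A₀(V)` both `κ`-coercive (`κ > 0`); `δA := A₀(U) − A₀(V)`; `Z` a finite set of fine sites):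
* §1 `blk_mul_mul` (`blk (PXQ) x y = Σ_zΣ_{z′} blk P x z · blk X z z′ · blk Q z′ y`), `norm_blk_triple_le`, `fullOpU_inv_sub_inv` (the resolvent identity for the two full operators).
* §2 ★★★ **`norm_blk_fullOpU_inv_sub_le_of_support`** — if `blk δA z z′ = 0` unless `z ∈ Z` and `z′ ∈ Z`, and `R_x ≤ d(x,z)`, `R_y ≤ d(z′,y)` for all `z, z′ ∈ Z`, then
  `‖blk (G(U) − G(V)) x y‖ ≤ (2∕κ)²·(Σ_{z∈Z}Σ_{z′∈Z}‖blk δA z z′‖)·e^{−ctRate·R_x∕L}·e^{−ctRate·R_y∕L}` for every `L ≥ 1`, every volume, every fibre;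
  ★★ `norm_blk_fullOpU_inv_sub_le_of_support_opNorm` (the mass bounded by `|Z|²·‖δA‖`).
PRIOR TREE ART (by name): Ϧ-a (`norm_blk_le_opNorm`, `isUnit_of_reCoercive`), Ϧ-c (`ctRate`, `norm_blk_fullOpU_inv_le_king`), Ϧ-f (`inv_sub_inv_eq`), Ͱ-n (`blk_mul'`, `blk_sub'`), Ϥ-d (`fullOpU`),
`King1986.Torus.tdistT`.  Dedup (rg at filing): basename 0 files; needles `blk_mul_mul|norm_blk_triple_le|norm_blk_fullOpU_inv_sub_le_of_support` 0 tree files.  Locators: [King1986] (4.33)–(4.34)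
p.674 (the propagators' exponential decay as the source of locality in §4); [Balaban1985BackgroundPropagators] (3.39) p.397, (3.48)–(3.50) pp.398–400 (shape: local dependence on the background);
[Dimock2013] App. D Lemma 30.  0 `sorry`, 0 `def`.
-/

noncomputable section
open scoped BigOperators ComplexConjugate ComplexOrder InnerProductSpace Matrix.Norms.L2Operator
open Finset Matrix WithLp

namespace Summit.QuantumFields.YangMills.BalabanUVNodes.N15KingModelRung.CombesThomas

open Literature.MathematicalPhysics.QuantumFieldTheory.LatticeDiamagneticInequality (blk)
open Literature.MathematicalPhysics.QuantumFieldTheory.Balaban1983to89.B5Prop11Plancherel (Tor fine)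
open Literature.MathematicalPhysics.QuantumFieldTheory.King1986.Torus (tdistT tdistT_nonneg)
open Summit.QuantumFields.YangMills.BalabanUVNodes.N15KingModelRung.Covariant (fib blk_mul' blk_sub')
open Summit.QuantumFields.YangMills.BalabanUVNodes.N15KingModelRung.CovariantBlock (BlockTree fullOpU)

variable {d : ℕ}
variable {𝕜 : Type*} [RCLike 𝕜] {n : Type*} [Fintype n] [DecidableEq n]

/-! ## §1 Triple products blockwise -/

section Triple

variable (K : Fin (d + 1) → ℕ) [hK : ∀ μ, NeZero (K μ)]

omit [DecidableEq n] in
/-- `blk (P·X·Q) x y = Σ_z Σ_{z′} blk P x z · blk X z z′ · blk Q z′ y`. [folklore] -/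
theorem blk_mul_mul (P X Q : Matrix (Tor K × n) (Tor K × n) 𝕜) (x y : Tor K) :
    blk (P * X * Q) x y = ∑ z, ∑ z', blk P x z * blk X z z' * blk Q z' y := by
  rw [blk_mul']
  rw [show (∑ z', blk (P * X) x z' * blk Q z' y) = ∑ z', (∑ z, blk P x z * blk X z z') * blk Q z' y from Finset.sum_congr rfl fun z' _ => by rw [blk_mul']]
  rw [Finset.sum_comm]
  exact Finset.sum_congr rfl fun z' _ => by rw [Finset.sum_mul]

/-- `‖blk (P·X·Q) x y‖ ≤ Σ_zΣ_{z′}‖blk P x z‖·‖blk X z z′‖·‖blk Q z′ y‖`. [folklore] -/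
theorem norm_blk_triple_le (P X Q : Matrix (Tor K × n) (Tor K × n) 𝕜) (x y : Tor K) :
    ‖blk (P * X * Q) x y‖ ≤ ∑ z, ∑ z', ‖blk P x z‖ * ‖blk X z z'‖ * ‖blk Q z' y‖ := by
  rw [blk_mul_mul]
  refine (norm_sum_le _ _).trans (Finset.sum_le_sum fun z _ => (norm_sum_le _ _).trans (Finset.sum_le_sum fun z' _ => ?_))
  exact (norm_mul_le _ _).trans (mul_le_mul_of_nonneg_right (norm_mul_le _ _) (norm_nonneg _))

end Triple

/-! ## §2 Locality -/

section Locality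

variable {L : ℕ} [NeZero L] (T : BlockTree d L) (M : Fin (d + 1) → ℕ) [hM : ∀ μ, NeZero (M μ)]

variable {a : ℝ} (ha : 0 ≤ a) (m2 : ℝ) {U V : Tor (fine L M) × Fin (d + 1) → Matrix n n 𝕜} (hU : ∀ bd, U bd ∈ Matrix.unitaryGroup n 𝕜) (hV : ∀ bd, V bd ∈ Matrix.unitaryGroup n 𝕜)
  {κ : ℝ} (hκ : 0 < κ)
  (hcoU : ∀ v : Tor (fine L M) × n → 𝕜, κ * ∑ x, ‖fib (fine L M) v x‖ ^ 2 ≤ RCLike.re (star v ⬝ᵥ (fullOpU T M a ((L : ℝ) ^ 2) m2 U *ᵥ v)))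
  (hcoV : ∀ v : Tor (fine L M) × n → 𝕜, κ * ∑ x, ‖fib (fine L M) v x‖ ^ 2 ≤ RCLike.re (star v ⬝ᵥ (fullOpU T M a ((L : ℝ) ^ 2) m2 V *ᵥ v)))
include ha hU hV hκ hcoU hcoV

omit ha hU hV in
/-- The resolvent identity for the two full operators: `G(U) − G(V) = G(U)·(A₀(V) − A₀(U))·G(V)`. [folklore] -/
theorem fullOpU_inv_sub_inv :
    (fullOpU T M a ((L : ℝ) ^ 2) m2 U)⁻¹ - (fullOpU T M a ((L : ℝ) ^ 2) m2 V)⁻¹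
      = (fullOpU T M a ((L : ℝ) ^ 2) m2 U)⁻¹ * (fullOpU T M a ((L : ℝ) ^ 2) m2 V - fullOpU T M a ((L : ℝ) ^ 2) m2 U) * (fullOpU T M a ((L : ℝ) ^ 2) m2 V)⁻¹ :=
  inv_sub_inv_eq (fine L M) (isUnit_of_reCoercive (fine L M) hκ hcoU) (isUnit_of_reCoercive (fine L M) hκ hcoV)

/-- ★★★ **LOCALITY OF THE RESPONSE**: if the fibre blocks of `A₀(U) − A₀(V)` vanish unless both sites lie in `Z`, and `R_x ≤ d(x,z)`, `R_y ≤ d(z′,y)` for all `z, z′ ∈ Z` (`R_x, R_y ≥ 0`), then for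
every `L ≥ 1`, every volume, every fibre:  `‖blk (G(U) − G(V)) x y‖ ≤ (2∕κ)²·(Σ_{z∈Z}Σ_{z′∈Z}‖blk (A₀(U) − A₀(V)) z z′‖)·e^{−ctRate·R_x∕L}·e^{−ctRate·R_y∕L}` — away from the support of the
perturbation the two propagators agree up to an exponentially small error. [cite: King1986, (4.33)–(4.34) p.674; Balaban1985BackgroundPropagators, (3.39) p.397, (3.48) p.398 (shape)] -/
theorem norm_blk_fullOpU_inv_sub_le_of_support (hL : 1 ≤ L) (Z : Finset (Tor (fine L M)))
    (hsupp : ∀ z z', (z ∉ Z ∨ z' ∉ Z) → blk (fullOpU T M a ((L : ℝ) ^ 2) m2 U - fullOpU T M a ((L : ℝ) ^ 2) m2 V) z z' = 0)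
    (x y : Tor (fine L M)) {Rx Ry : ℝ} (hRx : ∀ z ∈ Z, Rx ≤ tdistT (fine L M) x z) (hRy : ∀ z' ∈ Z, Ry ≤ tdistT (fine L M) z' y) :
    ‖blk ((fullOpU T M a ((L : ℝ) ^ 2) m2 U)⁻¹ - (fullOpU T M a ((L : ℝ) ^ 2) m2 V)⁻¹) x y‖
      ≤ (2 / κ) ^ 2 * (∑ z ∈ Z, ∑ z' ∈ Z, ‖blk (fullOpU T M a ((L : ℝ) ^ 2) m2 U - fullOpU T M a ((L : ℝ) ^ 2) m2 V) z z'‖)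
        * Real.exp (-(ctRate κ a d / L * Rx)) * Real.exp (-(ctRate κ a d / L * Ry)) := by
  set GU := (fullOpU T M a ((L : ℝ) ^ 2) m2 U)⁻¹ with hGU
  set GV := (fullOpU T M a ((L : ℝ) ^ 2) m2 V)⁻¹ with hGV
  set δA := fullOpU T M a ((L : ℝ) ^ 2) m2 U - fullOpU T M a ((L : ℝ) ^ 2) m2 V with hδA
  set θ := ctRate κ a d / L with hθ
  have hθ0 : 0 ≤ θ := div_nonneg (ctRate_nonneg κ a d) (Nat.cast_nonneg L)
  have hres : GU - GV = GU * (-δA) * GV := by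
    rw [hGU, hGV, fullOpU_inv_sub_inv T M m2 hκ hcoU hcoV, hδA, neg_sub]
  have hGUb : ∀ z, ‖blk GU x z‖ ≤ 2 / κ * Real.exp (-(θ * tdistT (fine L M) x z)) := fun z => norm_blk_fullOpU_inv_le_king T M ha m2 hU hκ hcoU hL x z
  have hGVb : ∀ z', ‖blk GV z' y‖ ≤ 2 / κ * Real.exp (-(θ * tdistT (fine L M) z' y)) := fun z' => norm_blk_fullOpU_inv_le_king T M ha m2 hV hκ hcoV hL z' y
  have hnegblk : ∀ z z', ‖blk (-δA) z z'‖ = ‖blk δA z z'‖ := fun z z' => by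
    rw [show blk (-δA) z z' = -blk δA z z' by ext i j; rfl, norm_neg]
  rw [hres]
  refine (norm_blk_triple_le (fine L M) GU (-δA) GV x y).trans ?_
  -- restrict the sums to `Z × Z`
  have hvanish : ∀ z z', (z ∉ Z ∨ z' ∉ Z) → ‖blk GU x z‖ * ‖blk (-δA) z z'‖ * ‖blk GV z' y‖ = 0 := fun z z' h => by
    rw [hnegblk, hsupp z z' h, norm_zero, mul_zero, zero_mul]
  have hrestrict : ∑ z, ∑ z', ‖blk GU x z‖ * ‖blk (-δA) z z'‖ * ‖blk GV z' y‖ = ∑ z ∈ Z, ∑ z' ∈ Z, ‖blk GU x z‖ * ‖blk δA z z'‖ * ‖blk GV z' y‖ := by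
    rw [← Finset.sum_subset (Finset.subset_univ Z) (fun z _ hz => Finset.sum_eq_zero fun z' _ => hvanish z z' (Or.inl hz))]
    refine Finset.sum_congr rfl fun z _ => ?_
    rw [← Finset.sum_subset (Finset.subset_univ Z) (fun z' _ hz' => hvanish z z' (Or.inr hz'))]
    exact Finset.sum_congr rfl fun z' _ => by rw [hnegblk]
  rw [hrestrict]
  -- bound each term
  have hterm : ∀ z ∈ Z, ∀ z' ∈ Z, ‖blk GU x z‖ * ‖blk δA z z'‖ * ‖blk GV z' y‖
      ≤ (2 / κ) ^ 2 * ‖blk δA z z'‖ * Real.exp (-(θ * Rx)) * Real.exp (-(θ * Ry)) := by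
    intro z hz z' hz'
    have h1 : ‖blk GU x z‖ ≤ 2 / κ * Real.exp (-(θ * Rx)) :=
      (hGUb z).trans (mul_le_mul_of_nonneg_left (Real.exp_le_exp.mpr (by nlinarith [hRx z hz])) (by positivity))
    have h2 : ‖blk GV z' y‖ ≤ 2 / κ * Real.exp (-(θ * Ry)) :=
      (hGVb z').trans (mul_le_mul_of_nonneg_left (Real.exp_le_exp.mpr (by nlinarith [hRy z' hz'])) (by positivity))
    calc ‖blk GU x z‖ * ‖blk δA z z'‖ * ‖blk GV z' y‖ ≤ (2 / κ * Real.exp (-(θ * Rx))) * ‖blk δA z z'‖ * (2 / κ * Real.exp (-(θ * Ry))) :=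
          mul_le_mul (mul_le_mul_of_nonneg_right h1 (norm_nonneg _)) h2 (norm_nonneg _) (by positivity)
      _ = (2 / κ) ^ 2 * ‖blk δA z z'‖ * Real.exp (-(θ * Rx)) * Real.exp (-(θ * Ry)) := by ring
  calc ∑ z ∈ Z, ∑ z' ∈ Z, ‖blk GU x z‖ * ‖blk δA z z'‖ * ‖blk GV z' y‖
      ≤ ∑ z ∈ Z, ∑ z' ∈ Z, (2 / κ) ^ 2 * ‖blk δA z z'‖ * Real.exp (-(θ * Rx)) * Real.exp (-(θ * Ry)) :=
        Finset.sum_le_sum fun z hz => Finset.sum_le_sum fun z' hz' => hterm z hz z' hz'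
    _ = (2 / κ) ^ 2 * (∑ z ∈ Z, ∑ z' ∈ Z, ‖blk δA z z'‖) * Real.exp (-(θ * Rx)) * Real.exp (-(θ * Ry)) := by
        rw [Finset.mul_sum, Finset.sum_mul, Finset.sum_mul]
        refine Finset.sum_congr rfl fun z _ => ?_
        rw [Finset.mul_sum, Finset.sum_mul, Finset.sum_mul]

/-- ★★ The same with the crude mass `|Z|²·‖A₀(U) − A₀(V)‖` (every block is bounded by the operator norm, PART Ϧ-a). [cite: King1986, (4.33)–(4.34) p.674] -/
theorem norm_blk_fullOpU_inv_sub_le_of_support_opNorm (hL : 1 ≤ L) (Z : Finset (Tor (fine L M)))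
    (hsupp : ∀ z z', (z ∉ Z ∨ z' ∉ Z) → blk (fullOpU T M a ((L : ℝ) ^ 2) m2 U - fullOpU T M a ((L : ℝ) ^ 2) m2 V) z z' = 0)
    (x y : Tor (fine L M)) {Rx Ry : ℝ} (hRx : ∀ z ∈ Z, Rx ≤ tdistT (fine L M) x z) (hRy : ∀ z' ∈ Z, Ry ≤ tdistT (fine L M) z' y) :
    ‖blk ((fullOpU T M a ((L : ℝ) ^ 2) m2 U)⁻¹ - (fullOpU T M a ((L : ℝ) ^ 2) m2 V)⁻¹) x y‖
      ≤ (2 / κ) ^ 2 * ((Z.card : ℝ) ^ 2 * ‖fullOpU T M a ((L : ℝ) ^ 2) m2 U - fullOpU T M a ((L : ℝ) ^ 2) m2 V‖)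
        * Real.exp (-(ctRate κ a d / L * Rx)) * Real.exp (-(ctRate κ a d / L * Ry)) := by
  refine (norm_blk_fullOpU_inv_sub_le_of_support T M ha m2 hU hV hκ hcoU hcoV hL Z hsupp x y hRx hRy).trans ?_
  refine mul_le_mul_of_nonneg_right (mul_le_mul_of_nonneg_right (mul_le_mul_of_nonneg_left ?_ (by positivity)) (Real.exp_nonneg _)) (Real.exp_nonneg _)
  calc ∑ z ∈ Z, ∑ z' ∈ Z, ‖blk (fullOpU T M a ((L : ℝ) ^ 2) m2 U - fullOpU T M a ((L : ℝ) ^ 2) m2 V) z z'‖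
      ≤ ∑ z ∈ Z, ∑ z' ∈ Z, ‖fullOpU T M a ((L : ℝ) ^ 2) m2 U - fullOpU T M a ((L : ℝ) ^ 2) m2 V‖ :=
        Finset.sum_le_sum fun z _ => Finset.sum_le_sum fun z' _ => norm_blk_le_opNorm (fine L M) _ z z'
    _ = (Z.card : ℝ) ^ 2 * ‖fullOpU T M a ((L : ℝ) ^ 2) m2 U - fullOpU T M a ((L : ℝ) ^ 2) m2 V‖ := by
        rw [Finset.sum_const, Finset.sum_const, nsmul_eq_mul, nsmul_eq_mul]; ring

end Locality

end Summit.QuantumFields.YangMills.BalabanUVNodes.N15KingModelRung.CombesThomas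

end
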